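/-
Copyright (c) 2026 the pub-hodgecm-mathlib formalisation cell (harness21).  Prover seat hodgecm-mathlib-K2Liu-p09 (g2): Track B «K2-LIT»,
#184♮ = hLiu418 = stmt-HodgeConjecture-24832, unit U5b «LOCAL SEAM OF s23», socket #29s `sig_K2LiuDoublingPartialEuler`, file (C0a):
the PINNED splitting of a Haar measure on `U(J)(𝔸_F)` along `G_∞ × G_S × G^S`; 2026-09-04.
-/
import Summits.HodgeConjecture.HodgeConjecture.Theorems.K2LiuDoublingZetaPlaceSplitting    -- ★ p04 (g2): `ν ≅ ν_∞ ⊗ (ν_S ⊗ ν^S)`, Fubini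
import Literature.NumberTheory.Automorphic.UnitaryGroupPureTensorEulerProduct              -- ★ `secondCountableTopology_localPi`, `locallyCompactSpace_localPi`
import Literature.MeasureTheory.RestrictedProduct.Haar                                     -- ★ `rpMeasure` is Haar, `eq_smul_rpMeasure`
import Mathlib.MeasureTheory.Measure.Haar.Unique
import HarnessLib

/-!
# Crux `HLiu418`, Track B road `K2_Liu`, unit U5b «LOCAL SEAM OF s23», socket #29s — file (C0a):
# THE PINNED SPLITTING `ν = ν_∞ ⊗ (⊗_{v∈S} ν_v) ⊗ ∏'_{v∉S}(ν_v; K_v)` OF A HAAR MEASURE ON `U(J)(𝔸_F)`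

Cell `hodgecm-mathlib`, crux item hLiu418 = `stmt-HodgeConjecture-24832`; squad K2 ∕ K2Liu, prover K2Liu-p09 (g2).  THEOREMS ONLY; lane
`--supports stmt-HodgeConjecture-24832` (helper for socket #29s `sig_K2LiuDoublingPartialEuler`).  Generic `F E c N J` (CM datum: `F = L⁺, E = L`, `c` = complex
conjugation, `J = H`).

* `isHaarMeasure_rpMeasure_localPi` — `∏'_{v∉S} (ν_v; K_v)` (★ `rpMeasure` of the local Haar measures, `ν_v(K_v) = 1` off `S`) is a σ-finite Haar measure on
  `Πʳ_{v∉S} [U(J)(F_v), U(J)(𝒪_v)]` (★ `isHaarMeasure_rpMeasure`, ★ `sigmaFinite_rpMeasure`).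
* `exists_isHaarMeasure_map_archSplit_eq_prod_pi_rpMeasure` — ★ p04's splitting `(g ↦ (g_∞, (g_v)_{v∈S}, (g_v)_{v∉S}))_* ν = ν_∞ ⊗ (ν_S ⊗ ν^S)` with the two
  finite-place factors PINNED to the given local Haar measures: `ν_S = ⊗_{v∈S} ν_v` (Mathlib `Measure.pi`, Haar by `Measure.pi.isHaarMeasure`) and `ν^S = ∏'_{v∉S} (ν_v; K_v)`;
  the two Haar-uniqueness scalars (Mathlib `isMulLeftInvariant_eq_smul`, `haarScalarFactor`) are absorbed into `ν_∞`, which therefore depends on `(ν, (ν_v), S)` only.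
[Borel–Jacquet (1979) §4.1; Tate, Cassels–Fröhlich Ch. XV §3.3; Bump (1997) §3.3 Prop. 3.3.2.]

HONEST LABEL.  Helper of socket #29s; by itself it retires no named input: `HC_CM` is proved only modulo the 7 printed citations (2 remaining named
inputs: hLiu418 = `stmt-HodgeConjecture-24832`, h413 = `stmt-HodgeConjecture-24833`) until rung 0 closes.
-/

set_option autoImplicit false
-- the mandated namespace repeats the single-problem summit's segment (`HodgeConjecture.HodgeConjecture`)
set_option linter.dupNamespace false

noncomputable section

open scoped RestrictedProduct ENNReal NNReal
open NumberField IsDedekindDomain MeasureTheory Measure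

namespace Summit.HodgeConjecture.HodgeConjecture.Cruxes.HLiu418.K2LiuDoublingHaarPinned

open Literature.NumberTheory.Automorphic
open Literature.NumberTheory.K2Lit.PlaceSplitting
open Literature.MeasureTheory.RestrictedProduct
open Summit.HodgeConjecture.HodgeConjecture.Cruxes.HLiu418.K2LiuAdelicPlaceSplittingFubini
open Summit.HodgeConjecture.HodgeConjecture.Cruxes.HLiu418.K2LiuDoublingZetaPlaceSplitting

variable (F E : Type) [Field F] [NumberField F] [Field E] [NumberField E] [Algebra F E]
  (c : E ≃ₐ[F] E) (N : ℕ) (J : Matrix (Fin N) (Fin N) E)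
  (S : Finset (HeightOneSpectrum (𝓞 F))) [DecidableEq (HeightOneSpectrum (𝓞 F))]

/-! ## §1 The pinned splitting of a Haar measure on `U(J)(𝔸_F)` -/

section Pinned

variable [MeasurableSpace (UnitaryGroup.adelicGroupData F E c N J).Adelic] [BorelSpace (UnitaryGroup.adelicGroupData F E c N J).Adelic]
  [MeasurableSpace (UnitaryGroup.arch F E c N J)] [BorelSpace (UnitaryGroup.arch F E c N J)]
  [∀ v : HeightOneSpectrum (𝓞 F), MeasurableSpace (UnitaryGroup.localPi E c N J v)]
  [∀ v : HeightOneSpectrum (𝓞 F), BorelSpace (UnitaryGroup.localPi E c N J v)]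

omit [DecidableEq (HeightOneSpectrum (𝓞 F))] [MeasurableSpace (UnitaryGroup.adelicGroupData F E c N J).Adelic]
  [BorelSpace (UnitaryGroup.adelicGroupData F E c N J).Adelic] [MeasurableSpace (UnitaryGroup.arch F E c N J)]
  [BorelSpace (UnitaryGroup.arch F E c N J)] in
/-- `∏'_{v∉S} (ν_v; K_v)` — the restricted product of the local Haar measures `ν_v` (`ν_v(K_v) = 1` off `S`) on `Πʳ_{v∉S} [U(J)(F_v), U(J)(𝒪_v)]` —
IS A σ-FINITE HAAR MEASURE (★ `isHaarMeasure_rpMeasure`, ★ `sigmaFinite_rpMeasure`). [cite: CasselsFrohlichANT1967, Ch. XV (Tate) §3.3] -/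
theorem isHaarMeasure_rpMeasure_localPi
    (νv : ∀ v : HeightOneSpectrum (𝓞 F), Measure (UnitaryGroup.localPi E c N J v)) [∀ v, (νv v).IsHaarMeasure]
    (hνK : ∀ v, v ∉ S → νv v (UnitaryGroup.localInt E c N J v : Set (UnitaryGroup.localPi E c N J v)) = 1) :
    (rpMeasure (fun v : {v // v ∉ S} => (UnitaryGroup.localInt E c N J v.1 : Set (UnitaryGroup.localPi E c N J v.1)))
        (fun v => νv v.1) ∅).IsHaarMeasure ∧
      SigmaFinite (rpMeasure (fun v : {v // v ∉ S} => (UnitaryGroup.localInt E c N J v.1 : Set (UnitaryGroup.localPi E c N J v.1)))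
        (fun v => νv v.1) ∅) := by
  haveI : Countable (HeightOneSpectrum (𝓞 F)) := countable_heightOneSpectrum F
  haveI : ∀ v, SecondCountableTopology (UnitaryGroup.localPi E c N J v) := fun v => UnitaryGroup.secondCountableTopology_localPi E N c J v
  haveI : ∀ v, LocallyCompactSpace (UnitaryGroup.localPi E c N J v) := fun v => UnitaryGroup.locallyCompactSpace_localPi E N c J v
  haveI := fact_isOpen_off (fun v => UnitaryGroup.localPi E c N J v) (fun v => UnitaryGroup.localInt E c N J v) S
  have hB1 : ∀ v : {v // v ∉ S}, v ∉ (∅ : Finset {v // v ∉ S}) →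
      νv v.1 (UnitaryGroup.localInt E c N J v.1 : Set (UnitaryGroup.localPi E c N J v.1)) = 1 := fun v _ => hνK v.1 v.2
  have hBm : ∀ v : {v // v ∉ S}, MeasurableSet (UnitaryGroup.localInt E c N J v.1 : Set (UnitaryGroup.localPi E c N J v.1)) :=
    fun v => (UnitaryGroup.isOpen_localInt E c N J v.1).measurableSet
  refine ⟨isHaarMeasure_rpMeasure (fun v : {v // v ∉ S} => UnitaryGroup.localInt E c N J v.1) ∅
    (fun v : {v // v ∉ S} => (⟨⟨(UnitaryGroup.localInt E c N J v.1 : Set (UnitaryGroup.localPi E c N J v.1)), UnitaryGroup.isCompact_localInt E c N J v.1⟩,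
      by
        show (interior (UnitaryGroup.localInt E c N J v.1 : Set (UnitaryGroup.localPi E c N J v.1))).Nonempty
        rw [(UnitaryGroup.isOpen_localInt E c N J v.1).interior_eq]
        exact ⟨1, (UnitaryGroup.localInt E c N J v.1).one_mem⟩⟩ : TopologicalSpace.PositiveCompacts (UnitaryGroup.localPi E c N J v.1)))
    (fun v => νv v.1) (fun v _ => UnitaryGroup.isCompact_localInt E c N J v.1) hB1,
    sigmaFinite_rpMeasure _ _ hBm (S₀ := ∅) hB1⟩

/-- **PINNED SPLITTING.**  For a Haar measure `ν` on `U(J)(𝔸_F)` and local Haar measures `ν_v` with `ν_v(K_v) = 1` off `S` there is a σ-finite Haar measure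
`ν_∞` on `U(J)(E ⊗ ℝ)` — depending on `(ν, (ν_v), S)` only — with
`(g ↦ (g_∞, ((g_v)_{v∈S}, (g_v)_{v∉S})))_* ν = ν_∞ ⊗ ((⊗_{v∈S} ν_v) ⊗ ∏'_{v∉S}(ν_v; K_v))`
(★ p04 `exists_isHaarMeasure_map_archSplit_eq_prod` + Haar uniqueness on the two finite-place factors, scalars absorbed into `ν_∞`).
[cite: BorelJacquet1979, §4.1] [cite: CasselsFrohlichANT1967, Ch. XV (Tate) §3.3] [cite: Bump1997, §3.3 Prop. 3.3.2] -/
theorem exists_isHaarMeasure_map_archSplit_eq_prod_pi_rpMeasure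
    (ν : Measure (UnitaryGroup.adelicGroupData F E c N J).Adelic) [ν.IsHaarMeasure]
    (νv : ∀ v : HeightOneSpectrum (𝓞 F), Measure (UnitaryGroup.localPi E c N J v)) [∀ v, (νv v).IsHaarMeasure]
    (hνK : ∀ v, v ∉ S → νv v (UnitaryGroup.localInt E c N J v : Set (UnitaryGroup.localPi E c N J v)) = 1) :
    ∃ νinf : Measure (UnitaryGroup.arch F E c N J), νinf.IsHaarMeasure ∧ SigmaFinite νinf ∧
      Measure.map (fun g => (UnitaryGroup.archPart F E c N J g, splitPlaces F E c N J S (UnitaryGroup.finPart F E c N J g))) ν =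
        νinf.prod ((Measure.pi fun v : S => νv v.1).prod
          (rpMeasure (fun v : {v // v ∉ S} => (UnitaryGroup.localInt E c N J v.1 : Set (UnitaryGroup.localPi E c N J v.1)))
            (fun v => νv v.1) ∅)) := by
  haveI : Countable (HeightOneSpectrum (𝓞 F)) := countable_heightOneSpectrum F
  haveI : ∀ v, SecondCountableTopology (UnitaryGroup.localPi E c N J v) := fun v => UnitaryGroup.secondCountableTopology_localPi E N c J v
  haveI : ∀ v, LocallyCompactSpace (UnitaryGroup.localPi E c N J v) := fun v => UnitaryGroup.locallyCompactSpace_localPi E N c J v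
  have hBc : ∀ v, IsCompact (UnitaryGroup.localInt E c N J v : Set (UnitaryGroup.localPi E c N J v)) :=
    fun v => UnitaryGroup.isCompact_localInt E c N J v
  haveI := fact_isOpen_off (fun v => UnitaryGroup.localPi E c N J v) (fun v => UnitaryGroup.localInt E c N J v) S
  haveI := borelSpace_off (fun v => UnitaryGroup.localPi E c N J v) (fun v => UnitaryGroup.localInt E c N J v) S
  haveI := secondCountableTopology_off (fun v => UnitaryGroup.localPi E c N J v) (fun v => UnitaryGroup.localInt E c N J v) S
  haveI := locallyCompactSpace_off (fun v => UnitaryGroup.localPi E c N J v) (fun v => UnitaryGroup.localInt E c N J v) S hBc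
  -- σ-finiteness of the local Haar measures
  haveI : ∀ v, SigmaFinite (νv v) := fun v => inferInstance
  obtain ⟨νinf, νS', νoff', hinf, hS', hoff', hσinf, hσS, hσoff, hmap⟩ := exists_isHaarMeasure_map_archSplit_eq_prod F E c N J S ν
  haveI := hinf; haveI := hS'; haveI := hoff'; haveI := hσinf
  obtain ⟨hrp, hσrp⟩ := isHaarMeasure_rpMeasure_localPi F E c N J S νv hνK
  haveI := hrp; haveI := hσrp
  -- Haar uniqueness on the two finite-place factors
  set piS : Measure (Π v : S, UnitaryGroup.localPi E c N J v.1) := Measure.pi fun v : S => νv v.1 with hpiS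
  set rpM := rpMeasure (fun v : {v // v ∉ S} => (UnitaryGroup.localInt E c N J v.1 : Set (UnitaryGroup.localPi E c N J v.1)))
    (fun v => νv v.1) ∅ with hrpM
  obtain ⟨a, ha, h1⟩ : ∃ a : ℝ≥0, 0 < a ∧ νS' = a • piS :=
    ⟨_, haarScalarFactor_pos_of_isHaarMeasure νS' piS, isMulLeftInvariant_eq_smul νS' piS⟩
  obtain ⟨b, hb, h2⟩ : ∃ b : ℝ≥0, 0 < b ∧ νoff' = b • rpM :=
    ⟨_, haarScalarFactor_pos_of_isHaarMeasure νoff' rpM, isMulLeftInvariant_eq_smul νoff' rpM⟩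
  refine ⟨(a * b) • νinf, IsHaarMeasure.nnreal_smul νinf (mul_pos ha hb).ne', inferInstance, ?_⟩
  rw [hmap, h1, h2]
  simp only [Measure.prod_smul_left, Measure.prod_smul_right, smul_smul, mul_comm]

end Pinned

end Summit.HodgeConjecture.HodgeConjecture.Cruxes.HLiu418.K2LiuDoublingHaarPinned

end
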